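import Literature.MathematicalPhysics.QuantumFieldTheory.Balaban1983to89.B15Prop1CriticalViaSlice
import Literature.MathematicalPhysics.QuantumFieldTheory.Balaban1983to89.B15Prop1AdjointOfRecord

/-!
# `Balaban1983to89.B15Prop1CriticalAtBoxG0` — [Balaban1989LargeFieldII] p. 358–359 *«G₀ determines the axial gauge in Λ … Fixing the
# gauge G₀ for V′ … the condition for a critical configuration is the equation (1.12)»*: THE (c3) LETTER OF THE N12∕s1 CHAIN
# DISCHARGED AT PRINT'S TREE `G₀` OF A PARALLELEPIPED — `IsCriticalPt ⇔ (1.12)` from the first-variation letter (m5), Λ-invariance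
# ((181)), Fréchet differentiability of `A ↦ f(exp(iA)·V)` and `r ≤ 1/2`

statement-level skeleton of published theorems with citation tags; proofs where landed; nothing here is a claim about
the Yang–Mills mass gap

Cell pub-ymgap, HUMAN RULING D-0062 (Track A full width), seat `pub-ymgap-dag-n12-c` (R134 acceleration seat (a), strategy s1 of DAG
node N12 = [B15]; generation g4, third product).  PDFs held: `paper:balaban1989-cmp122-large-field-i` (journal page = PDF page + 174),
`paper:balaban1989-cmp122-large-field-ii` (journal page = PDF page + 354).

THE PRINT.  [LF-II] p. 358: *«Let us explain at first the above statements in the simplest situation where the gauge is fixed in Λ and Λ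
is a cube or a rectangular parallelepiped. Then G₀ determines the axial gauge in Λ … B′ is determined on bonds of the x₁-direction …»*;
p. 359: *«Fixing the gauge G₀ for V′ we get a small configuration, and we can write V′ = exp iB′. We expand the function with respect to
B′ … Now the condition for a critical configuration is the equation (1.12)»*.  In the N12∕s1 chain of this seat (endpoint
`B15Prop1AdjointOfRecord.exists_domain_prop1Printed_lfVarOn_std_su2_box`, p485420) the last sentence is the letter (c3) `hc3`.

WHAT THIS FILE PROVES (Mathlib + the two imports; no `sorry`, no `… : Prop` fact, no definition, no `instance`, no `notation`; axioms
standard).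
§1 **`treeOrder_G0`** — print's `G₀` of a non-wrapping parallelepiped `[lo, hi]` (ALL bonds of the x₁-direction ending in `Λ`, the
   chain's `hTG0`) carries pv26's fresh-endpoint order `TreeOrder` (fresh end = target, rank = `T4AxialGaugeFixing.boxDepth` below the
   corner `lo − e₁`); `tgt_G0_mem` (its fresh ends are points of `Λ`).
§2 ★★ **`exists_domain_prop1Printed_lfVarOn_std_su2_box_of_fderiv`** — the endpoint of p485420 with the letter (c3) `hc3` NO LONGER A
   HYPOTHESIS: it is DERIVED (`B15Prop1CriticalViaSlice.isCriticalPt_iff_of_hasDerivAt` at `T = G₀`, `S = Λ^{(k)}`) from the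
   first-variation letter (m5) `hA` (kept), the Λ-invariance of (1.77) over (181) (`B15Eq177GaugeInvariance.fun177_gaugeAct`, from the
   kept `h181`∕`hk`), and TWO NEW, MORE PRIMITIVE letters: `hF` — `A ↦ A(U_{k,Z}((exp iA)·V))` is Fréchet differentiable at `A = 0` at
   every chart point `V = exp(i·ιA B)·Ṽ_k` of the ball (at print's instance a consequence of the analyticity of [15]'s minimiser, the
   same NODE 00 piece of record that carries (m5)) — and `hr2 : r ≤ 1/2` (*«B′ … small»*).

HONEST SCOPE.  (i) One letter traded for two more primitive ones; (c3) is now a theorem of chart calculus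
(`B15Prop1ChartCalculusSU2`, `B15Prop1CriticalViaSlice`).  (ii) Remaining hypotheses of the N12∕s1 chain after this file: `hlead` +
`hsm`∕`hγle`∕`hbxM`; `hH` ((190)); Prop. 4 data `emb`∕`W`∕`hW`∕`hWdV` + `hρ`∕`ha₃`∕`hsmall`; (m4) `hJ`; (m5) `hA`; `hF`; `hr2`; (181) `h181` +
`hk`; (x) `hAn`; structural box∕margin hypotheses.  (iii) `SU(2)`, parallelepipeds, `d ≥ 3` as in the chain.  Count-neutral; NOT a
discharge of N12; NOT summit progress; nothing continuum ∕ OS ∕ mass-gap ∕ Clay.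
-/

noncomputable section

open Set Finset
open scoped BigOperators Matrix RealInnerProductSpace Real
open Classical

namespace Literature.MathematicalPhysics.QuantumFieldTheory.Balaban1983to89.B15Prop1CriticalAtBoxG0

open B15DeterminingSets GaugeField B16Sect1Backgrounds B15Prop1Carrier B8Eq17ClassAkV1
open B15Prop1CarrierOnSU2Box B15Prop1SliceIneq18 B15Prop1CarrierOnSU2BoxIneq19 B15Prop1CarrierOnSU2BoxExt193 B15Prop1SliceIneq167
open B15Prop1StdInstanceSU2Box B15Prop1LipschitzFromProp4 B15Prop1AdjointOfRecord B15Prop1CriticalViaSlice B15Prop1ChartCalculusSU2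
open T4CubeChartGnomonic (SU2)
open B15Prop1ChartSU2 (su2Chart)
open B15Prop1SliceCoordinates (GaugeSlice ιA freeBonds)
open T4AxialGaugeSmallField (castSite boxPlaqs castSite_add_e castSite_injOn_box)
open T4AxialGaugeFixing (TreeOrder boxDepth boxDepth_castSite sum_e_apply)
open B7Prop1Explicit (e e_apply)
open B6BondElimination (unitVec unitVec_apply)
open B16Eq18Proof (box mem_box)
open B15Extension193 (extend)
open B15ShellGauge193 (shellGauge)
open B5Bounds167Lattice (formDk ofRealCfg)
open B14.Eq213DetSet B14.Eq216Concrete B14.Eq12InteriorLocality B15Sect1Instances B15Eq177GaugeInvariance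
open Literature.MathematicalPhysics.QuantumFieldTheory.BalabanImbrieJaffe1984to88.BIJ85Eq453GaugeField
open B11Prop6Scheme (Prop4Hyp)

variable {P : Params}

/-! ## §1 Print's `G₀` of a parallelepiped carries a fresh-endpoint order -/

/-- The two unit-vector notations of the cell agree. [folklore] -/
private theorem unitVec_eq_e (μ : Fin P.d) : (unitVec μ : Fin P.d → ℤ) = e μ := by
  funext i; simp [unitVec_apply, e_apply]

/-- `0 ≤ (e_μ)_κ` — bookkeeping. [folklore] -/
private theorem e_nonneg' {d : ℕ} (μ κ : Fin d) : (0 : ℤ) ≤ e μ κ := by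
  rw [e_apply]; split_ifs <;> norm_num

/-- **PRINT'S `G₀` IS TREE-LIKE.**  On a parallelepiped `[lo, hi]` whose extension by one step in the `−e₁` direction does not wrap around
the torus, the bond set `G₀ = {⟨x − e₁, e₁⟩ : x ∈ [lo, hi]}` (all x₁-bonds ending in `Λ`, the chain's `hTG0`) carries the fresh-endpoint
order: fresh end = target `x`, rank = the depth of `x` below the corner `lo − e₁` (pv26's `boxDepth`), which exceeds the depth of the
source `x − e₁` by one. [cite: Balaban1989LargeFieldII, p.358 («G₀ determines the axial gauge in Λ»)] -/
theorem treeOrder_G0 {k : ℕ} (h0 : 0 < P.d) {lo hi : Fin P.d → ℤ} (hN : ∀ κ, hi κ - lo κ + 1 < (P.sitesPerDir k : ℤ)) :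
    TreeOrder ((box (fun κ => (hi κ - lo κ + 1).toNat) lo).image fun x =>
        (⟨castSite (x - unitVec ⟨0, h0⟩), ⟨0, h0⟩⟩ : PBond P k))
      PBond.tgt (boxDepth (lo - e ⟨0, h0⟩) hi) := by
  have hN' : ∀ κ, hi κ - (lo - e ⟨0, h0⟩) κ < (P.sitesPerDir k : ℤ) := fun κ => by
    have h1 := hN κ; have h2 := e_nonneg' (d := P.d) ⟨0, h0⟩ κ
    have h3 : e ⟨0, h0⟩ κ ≤ (1 : ℤ) := by rw [e_apply]; split_ifs <;> norm_num
    simp only [Pi.sub_apply]; linarith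
  -- the shape of a member and its two ends
  have hmem : ∀ b ∈ (box (fun κ => (hi κ - lo κ + 1).toNat) lo).image
      (fun x => (⟨castSite (x - unitVec ⟨0, h0⟩), ⟨0, h0⟩⟩ : PBond P k)),
      ∃ x, (lo ≤ x ∧ x ≤ hi) ∧ b = ⟨castSite (x - e ⟨0, h0⟩), ⟨0, h0⟩⟩ := fun b hb => by
    obtain ⟨x, hx, hb⟩ := mem_G0_image h0 lo hi b hb
    exact ⟨x, hx, hb⟩
  have htgt : ∀ x : Fin P.d → ℤ, (⟨castSite (x - e ⟨0, h0⟩), ⟨0, h0⟩⟩ : PBond P k).tgt = castSite x := fun x => by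
    show (castSite (x - e ⟨0, h0⟩) : Site P k).shift ⟨0, h0⟩ = castSite x
    rw [← castSite_add_e, sub_add_cancel]
  -- depths
  have hdepth_tgt : ∀ x : Fin P.d → ℤ, lo ≤ x → x ≤ hi →
      boxDepth (lo - e ⟨0, h0⟩) hi (castSite x : Site P k) = (∑ κ, (x κ - lo κ) + 1).toNat := fun x hlo hhi => by
    have hlo' : lo - e ⟨0, h0⟩ ≤ x := fun κ => by have := hlo κ; have := e_nonneg' (d := P.d) ⟨0, h0⟩ κ; simp only [Pi.sub_apply]; linarith
    rw [boxDepth_castSite hN' hlo' hhi]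
    congr 1
    have h1 : ∀ κ, x κ - (lo - e ⟨0, h0⟩) κ = (x κ - lo κ) + e ⟨0, h0⟩ κ := fun κ => by simp only [Pi.sub_apply]; ring
    rw [Finset.sum_congr rfl fun κ _ => h1 κ, Finset.sum_add_distrib, sum_e_apply]
  have hdepth_src : ∀ x : Fin P.d → ℤ, lo ≤ x → x ≤ hi →
      boxDepth (lo - e ⟨0, h0⟩) hi (castSite (x - e ⟨0, h0⟩) : Site P k) = (∑ κ, (x κ - lo κ)).toNat := fun x hlo hhi => by
    have hlo' : lo - e ⟨0, h0⟩ ≤ x - e ⟨0, h0⟩ := fun κ => by have := hlo κ; simp only [Pi.sub_apply]; linarith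
    have hhi' : x - e ⟨0, h0⟩ ≤ hi := fun κ => by
      have := hhi κ; have := e_nonneg' (d := P.d) ⟨0, h0⟩ κ; simp only [Pi.sub_apply]; linarith
    rw [boxDepth_castSite hN' hlo' hhi']
    congr 1
    exact Finset.sum_congr rfl fun κ _ => by simp only [Pi.sub_apply]; ring
  refine ⟨fun _ _ => Or.inr rfl, fun b hb => ?_, fun b hb b' hb' hv => ?_, fun b hb => ?_⟩
  · -- no loop: `castSite (x − e₁) ≠ castSite x` on the big box
    obtain ⟨x, ⟨hlo, hhi⟩, rfl⟩ := hmem b hb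
    rw [htgt]
    intro h
    have hlo' : lo - e ⟨0, h0⟩ ≤ x - e ⟨0, h0⟩ := fun κ => by have := hlo κ; simp only [Pi.sub_apply]; linarith
    have hhi' : x - e ⟨0, h0⟩ ≤ hi := fun κ => by
      have := hhi κ; have := e_nonneg' (d := P.d) ⟨0, h0⟩ κ; simp only [Pi.sub_apply]; linarith
    have hlo'' : lo - e ⟨0, h0⟩ ≤ x := fun κ => by have := hlo κ; have := e_nonneg' (d := P.d) ⟨0, h0⟩ κ; simp only [Pi.sub_apply]; linarith
    have heq := castSite_injOn_box hN' hlo' hhi' hlo'' hhi h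
    have := congr_fun heq ⟨0, h0⟩
    simp [e_apply] at this
  · -- distinct bonds have distinct fresh ends
    obtain ⟨x, ⟨hlo, hhi⟩, rfl⟩ := hmem b hb
    obtain ⟨x', ⟨hlo', hhi'⟩, rfl⟩ := hmem b' hb'
    rw [htgt, htgt] at hv
    have hN0 : ∀ κ, hi κ - lo κ < (P.sitesPerDir k : ℤ) := fun κ => by have := hN κ; linarith
    rw [castSite_injOn_box hN0 hlo hhi hlo' hhi' hv]
  · -- the rank of the source is one less than the rank of the fresh end
    obtain ⟨x, ⟨hlo, hhi⟩, rfl⟩ := hmem b hb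
    refine Or.inl ?_
    rw [htgt, hdepth_tgt x hlo hhi]
    show boxDepth (lo - e ⟨0, h0⟩) hi (castSite (x - e ⟨0, h0⟩) : Site P k) < _
    rw [hdepth_src x hlo hhi]
    have hS : 0 ≤ ∑ κ, (x κ - lo κ) := Finset.sum_nonneg fun κ _ => by have := hlo κ; linarith
    omega

/-- The fresh ends of `G₀` are lattice points of `Λ = castSite '' [lo, hi]`. [cite: Balaban1989LargeFieldII, p.358] -/
theorem tgt_G0_mem {k : ℕ} (h0 : 0 < P.d) (lo hi : Fin P.d → ℤ) :
    ∀ b ∈ (box (fun κ => (hi κ - lo κ + 1).toNat) lo).image (fun x =>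
        (⟨castSite (x - unitVec ⟨0, h0⟩), ⟨0, h0⟩⟩ : PBond P k)),
      b.tgt ∈ (castSite '' Set.Icc lo hi : Set (Site P k)) := fun b hb => by
  obtain ⟨x, hx, rfl⟩ := mem_G0_image h0 lo hi b hb
  refine ⟨x, hx, ?_⟩
  show castSite x = (castSite (x - e ⟨0, h0⟩) : Site P k).shift ⟨0, h0⟩
  rw [← castSite_add_e, sub_add_cancel]

/-! ## §2 The N12∕s1 endpoint with the letter (c3) discharged -/

section Knit

/-- **PROPOSITION 1 [IV] FOR PRINT'S FUNCTION (1.77) AT `SU(2)` ON PARALLELEPIPEDS, WITH THE DOMAIN CONSTANT CHOSEN AND THE LETTER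
(c3) DISCHARGED.**  `B15Prop1AdjointOfRecord.exists_domain_prop1Printed_lfVarOn_std_su2_box` (p485420) with its hypothesis `hc3`
(`IsCriticalPt ⇔ (1.12)` at chart points of the ball) REPLACED by: `hF` — Fréchet differentiability at `A = 0` of
`A ↦ A(U_{k,Z}((exp iA)·V))` at every chart point `V = exp(i·ιA B)·Ṽ_k`, `‖B‖ ≤ r` — and `hr2 : r ≤ 1/2`; the equivalence is then
`B15Prop1CriticalViaSlice.isCriticalPt_iff_of_hasDerivAt` at print's `G₀` (`treeOrder_G0`, fresh ends in `Λ` by `tgt_G0_mem`), with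
the invariance of (1.77) under the transformations defined on `Λ` from (181) (`fun177_gaugeAct`) and the displayed first variation
`hA`.  [cite: Balaban1989LargeFieldI, Prop. 1 (1.77)–(1.78) p.194, p.193; Balaban1989LargeFieldII, pp.357–359, (1.12);
Balaban1985Variational, Prop. 4 pp.292–293, (181) p.307, (190) p.308] -/
theorem exists_domain_prop1Printed_lfVarOn_std_su2_box_of_fderiv (hd3 : 3 ≤ P.d) (h0 : 0 < P.d) {ι : Type}
    {av : ∀ j, Averaging P j SU2}
    (bg : DetBackground P SU2 av) (M₁ : ℕ) (Z Λ : ι → Set (Site P 0)) (k : ι → ℕ) (M : ι → ℝ)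
    (An : ∀ i, ℝ → GaugeField P (k i) SU2 → Prop) (hk : ∀ i, k i ≤ P.m + P.K)
    (h181 : ∀ i (u : GaugeTransf P (k i) SU2), Cov181 bg (Bj M₁ (Z i) (k i)) (blockLift (k i) u))
    (T : ∀ i, Finset (PBond P (k i)))
    {F : ι → Type*} [∀ i, NormedAddCommGroup (F i)] [∀ i, InnerProductSpace ℝ (F i)] [∀ i, FiniteDimensional ℝ (F i)]
    (H : ∀ i, GaugeField P (k i) SU2 →
      (GaugeSlice (pts (k i) (Λ i)) (T i) (EuclideanSpace ℝ (Fin 3)) →ₗ[ℝ] F i))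
    (Δ₁ : ∀ i, GaugeField P (k i) SU2 → (F i →ₗ[ℝ] F i)) (dV : ∀ i, GaugeField P (k i) SU2 → F i → F i)
    {Fc : ι → Type*} [∀ i, NormedAddCommGroup (Fc i)] [∀ i, NormedSpace ℂ (Fc i)] (emb : ∀ i, F i → Fc i)
    (hemb : ∀ i (u v : F i), ‖emb i u - emb i v‖ = ‖u - v‖) (hemb0 : ∀ i, emb i 0 = 0)
    (W : ∀ i, GaugeField P (k i) SU2 → Fc i → Fc i) {C₄ a₃ a : ι → ℝ} (hC₄ : ∀ i, 0 ≤ C₄ i) (ha : ∀ i, 0 < a i)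
    (hW : ∀ i Vk, Prop4Hyp (W i Vk) (C₄ i) (a₃ i)) (hWdV : ∀ i Vk (u : F i), W i Vk (emb i u) = emb i (dV i Vk u))
    (J : ∀ i, GaugeField P (k i) SU2 → F i)
    (lo hi : ι → Fin P.d → ℤ) (n : ι → ℕ) (hn : ∀ i κ, hi i κ ≤ lo i κ + n i) (hN : ∀ i, n i + 2 < P.sitesPerDir (k i))
    (hbox : ∀ i, pts (k i) (Λ i) = (castSite '' Set.Icc (lo i) (hi i) : Set (Site P (k i))))
    (hZ : ∀ i, (boxPlaqs (lo i - 1) (hi i + 1) : Set (Plaq P (k i))) ⊆ plaqsInside (pts (k i) (Z i)))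
    (hTG0 : ∀ i, T i = (box (fun κ => (hi i κ - lo i κ + 1).toNat) (lo i)).image fun x =>
      (⟨castSite (x - unitVec ⟨0, h0⟩), ⟨0, h0⟩⟩ : PBond P (k i)))
    (hN5 : ∀ i κ, ((hi i κ - lo i κ + 1).toNat : ℤ) + 5 < P.sitesPerDir (k i))
    (K : ι → ℕ) (hK1 : ∀ i, 1 ≤ K i) (hKn : ∀ i κ, (hi i κ - lo i κ + 1).toNat ≤ K i)
    (ext : ∀ i, GaugeField P (k i) SU2 → GaugeField P (k i) SU2)
    (hext : ∀ i Vk, ext i Vk = extend (pts (k i) (Λ i)) (shellGauge Vk (lo i) (hi i)) Vk)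
    (hlohi : ∀ i, lo i ≤ hi i)
    {γ h₁ cJ bx : ℝ} (hγ : 0 < γ) (hh₁ : 0 ≤ h₁) (hcJ : 0 ≤ cJ) (hbx : 0 ≤ bx)
    (hbxM : ∀ i, 12 * (P.d : ℝ) * ((n i : ℝ) + 2) ^ 2 ≤ bx * (M i) ^ 2)
    {ρ r eA Cerr : ι → ℝ} (hr : ∀ i, 0 < r i) (heA : ∀ i, 0 < eA i) (hM : ∀ i, 1 ≤ (M i))
    (n' : ι → ℕ) (hn' : ∀ i, 1 ≤ n' i)
    (hlead : ∀ i Vk (X : GaugeSlice (pts (k i) (Λ i)) (T i) (EuclideanSpace ℝ (Fin 3))),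
      |⟪H i Vk X, Δ₁ i Vk (H i Vk X)⟫ -
          ∑ a : Fin 3, formDk (n' i) (fun _ : Fin P.d => P.sitesPerDir (k i))
            (ofRealCfg (fun _ : Fin P.d => P.sitesPerDir (k i)) fun j =>
              ιA (pts (k i) (Λ i)) (T i) X ⟨j.1, j.2⟩ a)| ≤ Cerr i * ‖X‖ ^ 2)
    (hsm : ∀ i, Cerr i ≤ (4 / Real.pi ^ 2) ^ (P.d + 2) / (2 * (3 * (K i : ℝ) ^ 2 + 2 * (K i : ℝ) ^ 4)))
    (hγle : ∀ i, γ / (M i) ^ 5 ≤ (4 / Real.pi ^ 2) ^ (P.d + 2) / (2 * (3 * (K i : ℝ) ^ 2 + 2 * (K i : ℝ) ^ 4)))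
    (hH : ∀ i Vk x, ‖H i Vk x‖ ≤ h₁ * ‖x‖)
    (hρ : ∀ i, h₁ * r i ≤ ρ i) (ha₃ : ∀ i, 2 * (ρ i + a i) ≤ a₃ i)
    (hsmall : ∀ i, (M i) ^ 5 / γ * h₁ * (4 * C₄ i * (ρ i + a i)) * h₁ ≤ 1 / 2)
    (hA : ∀ i Vk (X δ : GaugeSlice (pts (k i) (Λ i)) (T i) (EuclideanSpace ℝ (Fin 3))),
      HasDerivAt (fun s : ℝ => (fun177std bg M₁ (Z i) (k i)) (expMul su2Chart (ιA (pts (k i) (Λ i)) (T i) (X + s • δ)) (ext i Vk)))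
      (⟪H i Vk δ, J i Vk⟫ + ⟪H i Vk δ, Δ₁ i Vk (H i Vk X)⟫ + ⟪H i Vk δ, dV i Vk (H i Vk X)⟫) 0)
    (hJ : ∀ i ε Vk, 0 < ε → PlaqSmallOn (plaqsInside (pts (k i) (Z i ∩ (Λ i)ᶜ))) ε Vk → ‖J i Vk‖ ≤ cJ * ε)
    -- (c3) REPLACED by: differentiability through the chart at the chart points of the ball, and `r ≤ 1/2`
    (hF : ∀ i Vk (B : GaugeSlice (pts (k i) (Λ i)) (T i) (EuclideanSpace ℝ (Fin 3))), ‖B‖ ≤ r i →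
      ∃ D : VecField P (k i) (EuclideanSpace ℝ (Fin 3)) →L[ℝ] ℝ,
        HasFDerivAt (fun A => (fun177std bg M₁ (Z i) (k i))
          (expMul su2Chart A (expMul su2Chart (ιA (pts (k i) (Λ i)) (T i) B) (ext i Vk)))) D 0)
    (hr2 : ∀ i, r i ≤ 1 / 2)
    (hAn : ∀ i ε Vk, 0 < ε → ε ≤ eA i → PlaqSmallOn (plaqsInside (pts (k i) (Z i ∩ (Λ i)ᶜ))) ε Vk → An i ε Vk)
    : ∃ a₁ : ι → ℝ, (∀ i, 0 < a₁ i) ∧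
      B15.Prop1Printed (lfVarOn su2Chart fun i => InstOn.std bg M₁ (Z i) (Λ i) (k i) (M i) (a₁ i) (An i)) := by
  refine exists_domain_prop1Printed_lfVarOn_std_su2_box hd3 h0 bg M₁ Z Λ k M An hk h181 T H Δ₁ dV emb hemb hemb0 W hC₄ ha hW
    hWdV J lo hi n hn hN hbox hZ hTG0 hN5 K hK1 hKn ext hext hlohi hγ hh₁ hcJ hbx hbxM hr heA hM n' hn' hlead hsm hγle hH hρ ha₃
    hsmall hA hJ (fun i Vk B hB => ?_) hAn
  -- (c3) at the chart point `exp(i·ιA B)·Ṽ_k`, `‖B‖ ≤ r i ≤ 1/2`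
  have hNw : ∀ κ, hi i κ - lo i κ + 1 < (P.sitesPerDir (k i) : ℤ) := fun κ => by
    have h5 := hN5 i κ
    have : hi i κ - lo i κ + 1 ≤ ((hi i κ - lo i κ + 1).toNat : ℤ) := Int.self_le_toNat _
    linarith
  have hT : TreeOrder (T i) PBond.tgt (boxDepth (lo i - e ⟨0, h0⟩) (hi i)) := by
    rw [hTG0 i]; exact treeOrder_G0 h0 hNw
  have hv : ∀ b ∈ T i, b.tgt ∈ pts (k i) (Λ i) := fun b hb => by
    rw [hbox i]; rw [hTG0 i] at hb; exact tgt_G0_mem h0 (lo i) (hi i) b hb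
  have hf : ∀ u : GaugeTransf P (k i) SU2, IsGaugeOn (pts (k i) (Λ i)) u →
      ∀ V, fun177std bg M₁ (Z i) (k i) (gaugeAct u V) = fun177std bg M₁ (Z i) (k i) V :=
    fun u _ V => fun177_gaugeAct bg M₁ (hk i) u (h181 i u) V
  obtain ⟨D, hD⟩ := hF i Vk B hB
  exact isCriticalPt_iff_of_hasDerivAt hT hv hf (ext i Vk) (hB.trans (hr2 i)) hD (fun δ => hA i Vk B δ)

end Knit

end Literature.MathematicalPhysics.QuantumFieldTheory.Balaban1983to89.B15Prop1CriticalAtBoxG0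

end
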